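import Literature.MathematicalPhysics.QuantumFieldTheory.ConformalBootstrap3D.MixedBlockCauchySchwarz
import Literature.MathematicalPhysics.QuantumFieldTheory.ConformalBootstrap3D.BlockUniquenessLimit
import Mathlib.Tactic
import HarnessLib

/-!
# The Dolan–Osborn `z`-series of the mixed-channel blocks at EVERY `Δ` strictly above the unitarity bound

`BlockZSeriesAB` / `MixedBlockCauchySchwarz` identify a genuine mixed-channel block (`IsConformalBlock3D Δ₁₂ Δ₃₄ Δ ℓ g`)
with its level series `Σ_n hrLevelAB` and, for `Δ₁₂ = -Δ₃₄`, with the non-negative `(n,j)` double series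
`Σ hrZTermAB (a,a)`, and give the absolutely convergent signed series of the `⟨σεσε⟩` family — all at REGULAR
points (`¬ accidentalDegeneracy3D Δ ℓ`), because the coefficient identification went through the generic clause.
Since `BlockUniquenessLimit.IsConformalBlock3D.eq_hrBlockAB_of_lt` (uniqueness at every `Δ` strictly above the
bound, accidental degeneracies included) the regularity hypothesis is unnecessary: the series are those of the
explicit function `hrBlockAB`, which converge by construction. This file records the `_of_lt` versions:
`hasSum_hrLevelAB_hrBlockAB`, `hasSum_hrZTermAB_hrBlockAB` (for `hrBlockAB` itself, any `Δ >` bound),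
`IsConformalBlock3D.hasSum_hrLevelAB_of_lt`, `IsConformalBlock3D.hasSum_hrZTermAB_of_lt`,
`IsConformalBlock3D.hasSum_hrZTermAB_neg_of_lt` (the signed `⟨σεσε⟩` series, absolutely convergent).
Used by the cell `pub-ising3x` (derivative-functional certificates, odd sector at accidental points).
Sources: F. A. Dolan, H. Osborn, Nucl. Phys. B 678 (2004) 491, §3 eqs. (3.9)–(3.12) (the series);
F. Kos, D. Poland, D. Simmons-Duffin, JHEP 11 (2014) 109, §4 (blocks at special `Δ` by continuation).
-/

namespace Literature.MathematicalPhysics.QuantumFieldTheory.ConformalBootstrap3D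

open Finset Set Filter Topology

/-- **The level series of `hrBlockAB` at a real point of the square, every `Δ` strictly above the bound**:
`hrBlockAB Δ₁₂ Δ₃₄ Δ ℓ (x,y) = Σ_n hrLevelAB (-Δ₁₂/2) (Δ₃₄/2) Δ ℓ x y n`. [cite: DolanOsborn2004, §3 eqs. (3.9)–(3.12)] -/
theorem hasSum_hrLevelAB_hrBlockAB (Δ₁₂ Δ₃₄ : ℝ) {Δ : ℝ} {ℓ : ℕ} (hΔ : unitarityBound3D ℓ < Δ) {x y : ℝ}
    (hx : x ∈ Ioo (0 : ℝ) 1) (hy : y ∈ Ioo (0 : ℝ) 1) :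
    HasSum (hrLevelAB (-Δ₁₂ / 2) (Δ₃₄ / 2) Δ ℓ x y) (hrBlockAB Δ₁₂ Δ₃₄ Δ ℓ x y) := by
  have hS := isDoublePowerSeriesOn_hrSeriesAB hΔ (a := -Δ₁₂ / 2) (b := Δ₃₄ / 2)
  have h1 := (hS.hasSum_antidiagonal hx.1.le hx.2 hy.1.le hy.2).mul_left ((x * y) ^ ((Δ - (ℓ : ℝ)) / 2))
  have hfun : (fun N : ℕ => (x * y) ^ ((Δ - (ℓ : ℝ)) / 2) *
      ∑ p ∈ antidiagonal N, hrMonomialCoeffAB (-Δ₁₂ / 2) (Δ₃₄ / 2) Δ ℓ p * x ^ p.1 * y ^ p.2) =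
      fun N : ℕ => ∑ j ∈ range (N + 1), hrZTermDegAB (-Δ₁₂ / 2) (Δ₃₄ / 2) Δ ℓ x y (N, j) :=
    funext fun N => (sum_range_hrZTermDegAB _ _ Δ ℓ x y N).symm
  rw [hfun] at h1
  have h2 := (hasSum_nat_add_iff' ℓ).mpr h1
  have hzero : ∑ i ∈ range ℓ, ∑ j ∈ range (i + 1), hrZTermDegAB (-Δ₁₂ / 2) (Δ₃₄ / 2) Δ ℓ x y (i, j) = 0 :=
    sum_eq_zero fun i hi => sum_eq_zero fun j _ => by
      unfold hrZTermDegAB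
      rw [if_neg (by simp only; have := mem_range.mp hi; omega)]
  rw [hzero, sub_zero] at h2
  have hfun' : (fun n : ℕ => ∑ j ∈ range (n + ℓ + 1), hrZTermDegAB (-Δ₁₂ / 2) (Δ₃₄ / 2) Δ ℓ x y (n + ℓ, j)) =
      hrLevelAB (-Δ₁₂ / 2) (Δ₃₄ / 2) Δ ℓ x y :=
    funext fun n => sum_range_hrZTermDegAB_shift hx.1 hy.1 n
  rw [hfun'] at h2
  unfold hrBlockAB
  exact h2

/-- **The level series of a genuine mixed-channel block at every `Δ` strictly above the bound** (accidental
degeneracies included; uniqueness `eq_hrBlockAB_of_lt`). [cite: DolanOsborn2004, §3 eqs. (3.9)–(3.12)] -/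
theorem IsConformalBlock3D.hasSum_hrLevelAB_of_lt {Δ₁₂ Δ₃₄ Δ : ℝ} {ℓ : ℕ} {g : ℝ → ℝ → ℝ}
    (hΔ : unitarityBound3D ℓ < Δ) (h : IsConformalBlock3D Δ₁₂ Δ₃₄ Δ ℓ g) {x y : ℝ} (hx : x ∈ Ioo (0 : ℝ) 1)
    (hy : y ∈ Ioo (0 : ℝ) 1) :
    HasSum (hrLevelAB (-Δ₁₂ / 2) (Δ₃₄ / 2) Δ ℓ x y) (g x y) := by
  rw [h.eq_hrBlockAB_of_lt hΔ x y hx hy]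
  exact hasSum_hrLevelAB_hrBlockAB Δ₁₂ Δ₃₄ hΔ hx hy

/-- **The non-negative `(n,j)` series of `hrBlockAB` for `Δ₁₂ = -Δ₃₄`, every `Δ` strictly above the bound.**
[cite: DolanOsborn2004, §3 eqs. (3.9)–(3.12)] -/
theorem hasSum_hrZTermAB_hrBlockAB {Δ₁₂ Δ₃₄ Δ : ℝ} {ℓ : ℕ} (hΔ : unitarityBound3D ℓ < Δ) (hab : Δ₁₂ = -Δ₃₄)
    {x y : ℝ} (hx : x ∈ Ioo (0 : ℝ) 1) (hy : y ∈ Ioo (0 : ℝ) 1) :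
    HasSum (hrZTermAB (Δ₃₄ / 2) (Δ₃₄ / 2) Δ ℓ x y) (hrBlockAB Δ₁₂ Δ₃₄ Δ ℓ x y) := by
  have h12 : -Δ₁₂ / 2 = Δ₃₄ / 2 := by rw [hab]; ring
  have hS := isDoublePowerSeriesOn_hrSeriesAB hΔ (a := Δ₃₄ / 2) (b := Δ₃₄ / 2)
  have h1 := (hS.hasSum_antidiagonal hx.1.le hx.2 hy.1.le hy.2).mul_left ((x * y) ^ ((Δ - (ℓ : ℝ)) / 2))
  have hfun : (fun N : ℕ => (x * y) ^ ((Δ - (ℓ : ℝ)) / 2) *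
      ∑ p ∈ antidiagonal N, hrMonomialCoeffAB (Δ₃₄ / 2) (Δ₃₄ / 2) Δ ℓ p * x ^ p.1 * y ^ p.2) =
      fun N : ℕ => ∑ j ∈ range (N + 1), hrZTermDegAB (Δ₃₄ / 2) (Δ₃₄ / 2) Δ ℓ x y (N, j) :=
    funext fun N => (sum_range_hrZTermDegAB _ _ Δ ℓ x y N).symm
  rw [hfun] at h1
  have h2 : HasSum (hrZTermDegAB (Δ₃₄ / 2) (Δ₃₄ / 2) Δ ℓ x y)
      ((x * y) ^ ((Δ - (ℓ : ℝ)) / 2) * hrSeriesAB (Δ₃₄ / 2) (Δ₃₄ / 2) Δ ℓ x y) :=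
    hasSum_prod_of_hasSum_rows (hrZTermDegAB_self_nonneg _ hΔ hx.1.le hy.1.le)
      (fun N j hNj => hrZTermDegAB_eq_zero_of_lt _ _ Δ ℓ x y hNj) h1
  have hinj : Function.Injective (fun q : ℕ × ℕ => (q.1 + ℓ, q.2)) := by
    intro p q hpq
    simp only [Prod.mk.injEq, add_left_inj] at hpq
    exact Prod.ext hpq.1 hpq.2
  have hoff : ∀ q : ℕ × ℕ, q ∉ Set.range (fun q : ℕ × ℕ => (q.1 + ℓ, q.2)) →
      hrZTermDegAB (Δ₃₄ / 2) (Δ₃₄ / 2) Δ ℓ x y q = 0 := by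
    intro q hq
    have hlt : q.1 < ℓ := by
      by_contra hge
      rw [not_lt] at hge
      exact hq ⟨(q.1 - ℓ, q.2), Prod.ext (Nat.sub_add_cancel hge) rfl⟩
    unfold hrZTermDegAB
    rw [if_neg (by omega)]
  have h3 := (hinj.hasSum_iff hoff).mpr h2
  have hfun' : (hrZTermDegAB (Δ₃₄ / 2) (Δ₃₄ / 2) Δ ℓ x y ∘ fun q : ℕ × ℕ => (q.1 + ℓ, q.2)) =
      hrZTermAB (Δ₃₄ / 2) (Δ₃₄ / 2) Δ ℓ x y :=
    funext fun q => hrZTermDegAB_shift hx.1 hy.1 q.1 q.2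
  rw [hfun'] at h3
  unfold hrBlockAB
  rw [h12]
  exact h3

/-- **The `(n,j)` series of a genuine block with `Δ₁₂ = -Δ₃₄` at every `Δ` strictly above the bound**
(accidental degeneracies included). [cite: DolanOsborn2004, §3 eqs. (3.9)–(3.12)] -/
theorem IsConformalBlock3D.hasSum_hrZTermAB_of_lt {Δ₁₂ Δ₃₄ Δ : ℝ} {ℓ : ℕ} {g : ℝ → ℝ → ℝ}
    (hΔ : unitarityBound3D ℓ < Δ) (hab : Δ₁₂ = -Δ₃₄) (h : IsConformalBlock3D Δ₁₂ Δ₃₄ Δ ℓ g) {x y : ℝ}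
    (hx : x ∈ Ioo (0 : ℝ) 1) (hy : y ∈ Ioo (0 : ℝ) 1) :
    HasSum (hrZTermAB (Δ₃₄ / 2) (Δ₃₄ / 2) Δ ℓ x y) (g x y) := by
  rw [h.eq_hrBlockAB_of_lt hΔ x y hx hy]
  exact hasSum_hrZTermAB_hrBlockAB hΔ hab hx hy

/-- **The signed `⟨σεσε⟩` series at every `Δ` strictly above the bound** (`Δ ≠ 1` if `ℓ = 0`): for `gmm` with
`IsConformalBlock3D s s Δ ℓ gmm` and `gpm` with `IsConformalBlock3D (-s) s Δ ℓ gpm`,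
`Σ_{(n,j)} (A_{n,j}(-s/2,s/2)/λ_ℓ) 𝒫_{Δ+n,j}(x,y) = gmm(x,y)` ABSOLUTELY (domination by `gpm` and `v^s gpm`).
[cite: DolanOsborn2004, §3 eq. (3.11)] -/
theorem IsConformalBlock3D.hasSum_hrZTermAB_neg_of_lt {s Δ : ℝ} {ℓ : ℕ} {gmm gpm : ℝ → ℝ → ℝ}
    (hΔ : unitarityBound3D ℓ < Δ) (h1 : ℓ = 0 → Δ ≠ 1) (hmm : IsConformalBlock3D s s Δ ℓ gmm)
    (hpm : IsConformalBlock3D (-s) s Δ ℓ gpm) {x y : ℝ} (hx : x ∈ Ioo (0 : ℝ) 1) (hy : y ∈ Ioo (0 : ℝ) 1) :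
    HasSum (hrZTermAB (-s / 2) (s / 2) Δ ℓ x y) (gmm x y) ∧
      Summable (fun q => |hrZTermAB (-s / 2) (s / 2) Δ ℓ x y q|) := by
  have hP : HasSum (hrZTermAB (s / 2) (s / 2) Δ ℓ x y) (gpm x y) := hpm.hasSum_hrZTermAB_of_lt hΔ (by ring) hx hy
  have hconj : IsConformalBlock3D s (-s) Δ ℓ (conjBlock s gpm) := by
    have h := hpm.conj
    have he : (s - -s) / 2 = s := by ring
    rw [neg_neg, he] at h
    exact h
  have hQ : HasSum (hrZTermAB (-s / 2) (-s / 2) Δ ℓ x y) (conjBlock s gpm x y) :=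
    hconj.hasSum_hrZTermAB_of_lt hΔ (by ring) hx hy
  have hsq := hrZTermAB_neg_sq_eq_mul hΔ h1 s x y
  have hPnn := fun q => hrZTermAB_self_nonneg (s / 2) hΔ hx.1.le hy.1.le q
  have hQnn := fun q => hrZTermAB_self_nonneg (-s / 2) hΔ hx.1.le hy.1.le q
  have habs : Summable (fun q => |hrZTermAB (-s / 2) (s / 2) Δ ℓ x y q|) :=
    summable_abs_of_sq_eq_mul hsq hPnn hQnn hP hQ
  refine ⟨?_, habs⟩
  have hT : HasSum (hrZTermAB (-s / 2) (s / 2) Δ ℓ x y) (∑' q, hrZTermAB (-s / 2) (s / 2) Δ ℓ x y q) :=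
    (habs.of_norm_bounded (fun q => by rw [Real.norm_eq_abs])).hasSum
  have hfib : ∀ n : ℕ, HasSum (fun j : ℕ => hrZTermAB (-s / 2) (s / 2) Δ ℓ x y (n, j))
      (hrLevelAB (-s / 2) (s / 2) Δ ℓ x y n) := by
    intro n
    unfold hrLevelAB
    refine hasSum_sum_of_ne_finset_zero fun j hj => ?_
    rw [Finset.mem_range, not_lt] at hj
    unfold hrZTermAB
    simp only
    rw [hrCoeffAB_eq_zero_of_lt _ _ Δ (show ℓ + n < j by omega), zero_div, zero_mul]
  have hlev : HasSum (hrLevelAB (-s / 2) (s / 2) Δ ℓ x y)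
      (∑' q, hrZTermAB (-s / 2) (s / 2) Δ ℓ x y q) := hT.prod_fiberwise hfib
  have hlev' : HasSum (hrLevelAB (-s / 2) (s / 2) Δ ℓ x y) (gmm x y) := hmm.hasSum_hrLevelAB_of_lt hΔ hx hy
  rwa [hlev.unique hlev'] at hT

end Literature.MathematicalPhysics.QuantumFieldTheory.ConformalBootstrap3D
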